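import Mathlib
import HarnessLib
import Summits.Langlands.Langlands.Theses.EisensteinGelfandKirillov
import Literature.NumberTheory.QuadraticForms.HilbertReciprocityRat
import Literature.NumberTheory.GaloisRepresentations.OrdinaryTwistedDeterminant

/-!
# Route `EisensteinGelfandKirillov`, crux `ProModularOfGKBound` (stmt-Langlands-18273), line `two-leaf-fern`:
# sub-goal `stub_algEquivExtend` of `stub_host` — continuous ring maps out of closed subrings of a finite
# extension of `ℚ_p` inside `ℚ̄_p` extend to `Gal(ℚ̄_p/ℚ_p)`

The construction of the pseudo-deformation host of the line (`stub_host`, the trace algebra) needs, for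
its Galois-equivariant fixed-determinant clause (D), the following piece of `p`-adic field theory:

**Theorem (`stub_algEquivExtend`).** Let `E ⊆ ℚ̄_p` be a finite extension of `ℚ_p`, `Λ ⊆ E` a subring of
`ℚ̄_p` which is CLOSED in `ℚ̄_p`, and `ψ : Λ → ℚ̄_p` a CONTINUOUS ring homomorphism.  Then there is a
`ℚ_p`-algebra automorphism `σ` of `ℚ̄_p` with `σ|_Λ = ψ`.

Proof: `Λ ⊇ ℤ_p` (closure of `ℤ`) and `ψ|_{ℤ_p} = id` (continuity and density of `ℤ`); the field
`K = ℚ_p(Λ) ⊆ E` is the localisation `Λ[1/p]` (every element of `ℚ_p(Λ) = ℚ_p·Λ` becomes an element of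
`Λ` after multiplication by a power of `p`), so `ψ` extends to a ring map `K → ℚ̄_p` which is
`ℚ_p`-linear; it extends to `ℚ̄_p → ℚ̄_p` by normality of `ℚ̄_p/ℚ_p` (Mathlib `AlgHom.liftNormal`), and an
algebra endomorphism of an algebraic extension is bijective.  Standard; no named fact.
[cite: SerreLocalFields1979, Ch. II §2 (finite extensions of ℚ_p)] (folklore field theory otherwise).
-/

set_option linter.dupNamespace false
set_option autoImplicit false

noncomputable section

open scoped NumberField
open Filter Topology Literature.NumberTheory.GaloisRepresentations

namespace Summit.Langlands.Langlands.Cruxes.ProModularOfGKBound.TwoLeafFern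

namespace AlgEquivExtend

variable {p : ℕ} [Fact p.Prime]

/-- A closed subring of `ℚ̄_p` contains `ℤ_p` (the closure of `ℤ`). [folklore] -/
theorem algebraMap_padicInt_mem (Λ : Subring (PadicAlgCl p)) (hΛ : IsClosed (Λ : Set (PadicAlgCl p)))
    (z : ℤ_[p]) : algebraMap ℤ_[p] (PadicAlgCl p) z ∈ Λ := by
  have hz : z ∈ closure (Set.range (Int.cast : ℤ → ℤ_[p])) := PadicInt.denseRange_intCast z
  have h1 : algebraMap ℤ_[p] (PadicAlgCl p) z ∈
      closure (algebraMap ℤ_[p] (PadicAlgCl p) '' Set.range (Int.cast : ℤ → ℤ_[p])) :=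
    map_mem_closure (continuous_algebraMap_padicInt_padicAlgCl p) hz (fun x hx => Set.mem_image_of_mem _ hx)
  have h2 : algebraMap ℤ_[p] (PadicAlgCl p) '' Set.range (Int.cast : ℤ → ℤ_[p]) ⊆ Λ := by
    rintro _ ⟨_, ⟨n, rfl⟩, rfl⟩
    rw [map_intCast]
    exact intCast_mem Λ n
  exact (hΛ.closure_subset_iff.2 h2) h1

/-- A continuous ring map on a closed subring of `ℚ̄_p` fixes `ℤ_p` pointwise. [folklore] -/
theorem apply_algebraMap_padicInt (Λ : Subring (PadicAlgCl p)) (hΛ : IsClosed (Λ : Set (PadicAlgCl p)))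
    (ψ : Λ →+* PadicAlgCl p) (hψ : Continuous ψ) (z : ℤ_[p]) :
    ψ ⟨algebraMap ℤ_[p] (PadicAlgCl p) z, algebraMap_padicInt_mem Λ hΛ z⟩ =
      algebraMap ℤ_[p] (PadicAlgCl p) z := by
  let f : ℤ_[p] → PadicAlgCl p := fun z =>
    ψ ⟨algebraMap ℤ_[p] (PadicAlgCl p) z, algebraMap_padicInt_mem Λ hΛ z⟩
  have hf : Continuous f :=
    hψ.comp ((continuous_algebraMap_padicInt_padicAlgCl p).subtype_mk fun z => algebraMap_padicInt_mem Λ hΛ z)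
  have hg : Continuous (algebraMap ℤ_[p] (PadicAlgCl p)) := continuous_algebraMap_padicInt_padicAlgCl p
  have heq : f = algebraMap ℤ_[p] (PadicAlgCl p) := by
    refine Continuous.ext_on PadicInt.denseRange_intCast hf hg ?_
    rintro _ ⟨n, rfl⟩
    show ψ ⟨algebraMap ℤ_[p] (PadicAlgCl p) (n : ℤ_[p]), _⟩ = algebraMap ℤ_[p] (PadicAlgCl p) (n : ℤ_[p])
    have e : algebraMap ℤ_[p] (PadicAlgCl p) (n : ℤ_[p]) = (n : PadicAlgCl p) := map_intCast _ n
    have h1 : (⟨algebraMap ℤ_[p] (PadicAlgCl p) (n : ℤ_[p]), algebraMap_padicInt_mem Λ hΛ n⟩ : Λ) =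
        (n : Λ) := Subtype.ext (by
          show algebraMap ℤ_[p] (PadicAlgCl p) (n : ℤ_[p]) = ((n : Λ) : PadicAlgCl p)
          rw [e]; norm_cast)
    rw [h1, map_intCast, e]
  exact congrFun heq z

end AlgEquivExtend

open AlgEquivExtend in
/-- **Sub-goal `stub_algEquivExtend` of `stub_host`.**  A continuous ring homomorphism `ψ : Λ → ℚ̄_p` on a
CLOSED subring `Λ` of `ℚ̄_p` contained in a finite extension `E` of `ℚ_p` is the restriction of an element
of `Gal(ℚ̄_p/ℚ_p)`: `∃ σ : ℚ̄_p ≃ₐ[ℚ_p] ℚ̄_p, σ|_Λ = ψ`.  (`Λ ⊇ ℤ_p`, `ψ|_{ℤ_p} = id`, `ℚ_p(Λ) = Λ[1/p]`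
is a localisation so `ψ` extends `ℚ_p`-linearly to it, then to `ℚ̄_p` by `AlgHom.liftNormal`, and is
bijective by algebraicity.) [folklore] -/
theorem stub_algEquivExtend : ∀ (p : ℕ) [Fact p.Prime] (E : IntermediateField ℚ_[p] (PadicAlgCl p)), FiniteDimensional ℚ_[p] E → ∀ (Λ : Subring (PadicAlgCl p)), IsClosed (Λ : Set (PadicAlgCl p)) → Λ ≤ E.toSubring → ∀ (ψ : Λ →+* PadicAlgCl p), Continuous ψ → ∃ σ : PadicAlgCl p ≃ₐ[ℚ_[p]] PadicAlgCl p, ∀ x : Λ, σ x = ψ x := by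
  intro p _ E hE Λ hΛ hΛE ψ hψ
  -- the field `K = ℚ_p(Λ) ⊆ E`
  let K : IntermediateField ℚ_[p] (PadicAlgCl p) := IntermediateField.adjoin ℚ_[p] (Λ : Set (PadicAlgCl p))
  have hKE : K ≤ E := IntermediateField.adjoin_le_iff.2 hΛE
  haveI : FiniteDimensional ℚ_[p] E := hE
  haveI : FiniteDimensional ℚ_[p] K :=
    FiniteDimensional.of_injective (IntermediateField.inclusion hKE).toLinearMap
      (IntermediateField.inclusion hKE).injective
  have hΛK : ∀ x : Λ, (x : PadicAlgCl p) ∈ K := fun x => IntermediateField.subset_adjoin _ _ x.2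
  -- `Λ → K`
  let i : Λ →+* K := (Λ.subtype).codRestrict K hΛK
  have hi : ∀ x : Λ, ((i x : K) : PadicAlgCl p) = x := fun x => rfl
  letI : Algebra Λ K := i.toAlgebra
  have halg : ∀ x : Λ, ((algebraMap Λ K x : K) : PadicAlgCl p) = x := fun x => rfl
  -- `p ∈ Λ` and the submonoid of its powers
  have hpΛ : (p : PadicAlgCl p) ∈ Λ := natCast_mem Λ p
  let pΛ : Λ := ⟨(p : PadicAlgCl p), hpΛ⟩
  let M : Submonoid Λ := Submonoid.powers pΛ
  have hp0 : (p : PadicAlgCl p) ≠ 0 := Nat.cast_ne_zero.2 (Fact.out : p.Prime).ne_zero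
  -- `K` is the localisation `Λ[1/p]`
  haveI : IsLocalization M K := by
    refine ⟨?_, ?_, ?_⟩
    · rintro ⟨y, n, rfl⟩
      refine isUnit_iff_ne_zero.2 fun h => ?_
      have h' : (((algebraMap Λ K) (pΛ ^ n) : K) : PadicAlgCl p) = 0 := by
        rw [h]; rfl
      rw [halg, SubmonoidClass.coe_pow] at h'
      exact pow_ne_zero n hp0 h'
    · intro k
      -- every element of `K = ℚ_p · Λ` lies in `Λ` after multiplication by a power of `p`
      have hk : (k : PadicAlgCl p) ∈ (Algebra.adjoin ℚ_[p] (Λ : Set (PadicAlgCl p)) :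
          Subalgebra ℚ_[p] (PadicAlgCl p)) := by
        have := k.2
        rw [← IntermediateField.mem_toSubalgebra, IntermediateField.adjoin_toSubalgebra_of_isAlgebraic
          (fun x _ => Algebra.IsAlgebraic.isAlgebraic x)] at this
        exact this
      have hk' : (k : PadicAlgCl p) ∈ Submodule.span ℚ_[p]
          ((Submonoid.closure (Λ : Set (PadicAlgCl p)) : Submonoid (PadicAlgCl p)) : Set (PadicAlgCl p)) := by
        rw [← Algebra.adjoin_eq_span]; exact hk
      have hcl : ((Submonoid.closure (Λ : Set (PadicAlgCl p)) : Submonoid (PadicAlgCl p)) :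
          Set (PadicAlgCl p)) = Λ := by
        have : Submonoid.closure (Λ : Set (PadicAlgCl p)) = Λ.toSubmonoid :=
          Submonoid.closure_eq_of_le (fun x hx => hx) (fun x hx => Submonoid.subset_closure hx)
        rw [this]
        rfl
      rw [hcl] at hk'
      -- claim: ∃ m, ∃ λ ∈ Λ, p^m * k = λ
      suffices h : ∃ (m : ℕ) (l : Λ), (p : PadicAlgCl p) ^ m * (k : PadicAlgCl p) = l by
        obtain ⟨m, l, hl⟩ := h
        refine ⟨⟨l, ⟨pΛ ^ m, m, rfl⟩⟩, Subtype.ext ?_⟩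
        change (k : PadicAlgCl p) * ((algebraMap Λ K (pΛ ^ m) : K) : PadicAlgCl p) =
          ((algebraMap Λ K l : K) : PadicAlgCl p)
        rw [halg, halg, SubmonoidClass.coe_pow, mul_comm]
        exact hl
      refine Submodule.span_induction (p := fun x _ => ∃ (m : ℕ) (l : Λ), (p : PadicAlgCl p) ^ m * x = l)
        ?_ ?_ ?_ ?_ hk'
      · intro x hx
        exact ⟨0, ⟨x, hx⟩, by simp⟩
      · exact ⟨0, 0, by simp⟩
      · rintro x y - - ⟨m, l, hl⟩ ⟨m', l', hl'⟩
        refine ⟨m + m', pΛ ^ m' * l + pΛ ^ m * l', ?_⟩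
        simp only [Subring.coe_add, Subring.coe_mul, SubmonoidClass.coe_pow]
        rw [pow_add, mul_add, ← hl, ← hl']
        ring
      · rintro q x - ⟨m, l, hl⟩
        obtain ⟨m', z, hz⟩ := Literature.NumberTheory.QuadraticForms.Dyadic.exists_pow_mul_mem_padicInt (p := p) q
        refine ⟨m' + m, ⟨algebraMap ℤ_[p] (PadicAlgCl p) z, algebraMap_padicInt_mem Λ hΛ z⟩ * l, ?_⟩
        simp only [Subring.coe_mul]
        have hz' : algebraMap ℤ_[p] (PadicAlgCl p) z = (p : PadicAlgCl p) ^ m' * algebraMap ℚ_[p] (PadicAlgCl p) q := by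
          rw [IsScalarTower.algebraMap_apply ℤ_[p] ℚ_[p] (PadicAlgCl p), show algebraMap ℤ_[p] ℚ_[p] z = (z : ℚ_[p]) from rfl,
            hz, map_mul, map_pow, map_natCast]
        rw [hz', ← hl, Algebra.smul_def, pow_add]
        ring
    · intro x y h
      refine ⟨1, ?_⟩
      have : (x : PadicAlgCl p) = y := by
        have := congrArg (fun k : K => (k : PadicAlgCl p)) h
        simpa [halg] using this
      rw [Subtype.ext this]
  -- extend `ψ` to `K`
  have hψM : ∀ y : M, IsUnit (ψ y) := by
    rintro ⟨y, n, rfl⟩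
    refine isUnit_iff_ne_zero.2 ?_
    rw [map_pow]
    refine pow_ne_zero n ?_
    have : ψ pΛ = p := by
      have h := apply_algebraMap_padicInt Λ hΛ ψ hψ (p : ℤ_[p])
      have e : algebraMap ℤ_[p] (PadicAlgCl p) (p : ℤ_[p]) = (p : PadicAlgCl p) := map_natCast _ p
      have h1 : (⟨algebraMap ℤ_[p] (PadicAlgCl p) (p : ℤ_[p]), algebraMap_padicInt_mem Λ hΛ p⟩ : Λ) = pΛ :=
        Subtype.ext e
      rw [h1, e] at h
      exact h
    rw [this]
    exact hp0
  let φ₀ : K →+* PadicAlgCl p := IsLocalization.lift (M := M) hψM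
  have hφ₀ : ∀ x : Λ, φ₀ (algebraMap Λ K x) = ψ x := fun x => IsLocalization.lift_eq hψM x
  -- `φ₀` is `ℚ_p`-linear
  have hφ₀Q : ∀ q : ℚ_[p], φ₀ (algebraMap ℚ_[p] K q) = algebraMap ℚ_[p] (PadicAlgCl p) q := by
    intro q
    obtain ⟨m, z, hz⟩ := Literature.NumberTheory.QuadraticForms.Dyadic.exists_pow_mul_mem_padicInt (p := p) q
    have hzΛ := algebraMap_padicInt_mem Λ hΛ z
    have h1 : algebraMap Λ K ⟨_, hzΛ⟩ = algebraMap ℚ_[p] K ((p : ℚ_[p]) ^ m * q) := by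
      apply Subtype.ext
      rw [halg]
      change algebraMap ℤ_[p] (PadicAlgCl p) z = ((algebraMap ℚ_[p] K ((p : ℚ_[p]) ^ m * q) : K) : PadicAlgCl p)
      rw [IsScalarTower.algebraMap_apply ℤ_[p] ℚ_[p] (PadicAlgCl p),
        show algebraMap ℤ_[p] ℚ_[p] z = (z : ℚ_[p]) from rfl, hz]
      rfl
    have h2 : φ₀ (algebraMap ℚ_[p] K ((p : ℚ_[p]) ^ m * q)) = algebraMap ℤ_[p] (PadicAlgCl p) z := by
      rw [← h1, hφ₀]
      exact apply_algebraMap_padicInt Λ hΛ ψ hψ z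
    rw [map_mul, map_mul, map_pow, map_natCast, map_pow, map_natCast,
      IsScalarTower.algebraMap_apply ℤ_[p] ℚ_[p] (PadicAlgCl p),
      show algebraMap ℤ_[p] ℚ_[p] z = (z : ℚ_[p]) from rfl, hz, map_mul, map_pow, map_natCast] at h2
    exact mul_left_cancel₀ (pow_ne_zero m hp0) h2
  let φ : K →ₐ[ℚ_[p]] PadicAlgCl p := { φ₀ with commutes' := hφ₀Q }
  -- extend to `ℚ̄_p` by normality, and upgrade to an automorphism
  let σ₀ : PadicAlgCl p →ₐ[ℚ_[p]] PadicAlgCl p := φ.liftNormal (PadicAlgCl p)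
  have hσ₀ : ∀ x : Λ, σ₀ x = ψ x := by
    intro x
    have h := AlgHom.liftNormal_commutes φ (PadicAlgCl p) (algebraMap Λ K x)
    rw [show algebraMap K (PadicAlgCl p) (algebraMap Λ K x) = (x : PadicAlgCl p) from rfl] at h
    rw [h]
    exact hφ₀ x
  refine ⟨AlgEquiv.ofBijective σ₀ (Algebra.IsAlgebraic.algHom_bijective σ₀), fun x => ?_⟩
  rw [AlgEquiv.ofBijective_apply]
  exact hσ₀ x

end Summit.Langlands.Langlands.Cruxes.ProModularOfGKBound.TwoLeafFern

end
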